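import Literature.Probability.RandomPlanarGeometry.LeftFillingConfigs
import Literature.Probability.RandomPlanarGeometry.LoewnerHullUnion
import Literature.Probability.RandomPlanarGeometry.SLEKappaRhoRestrictionProofs
import HarnessLib

/-!
# `K = F^{ℝ₊}_ℍ(cl K_∞)` of SLE(8/3, ρ) is a random element of `Ω₊`: reduction to two sample-path facts, and [LSW] Thm. 8.4 from its printed leaves

Decomposition of the named fact
`Literature.Probability.RandomPlanarGeometry.SLEKappaRho.exists_measurable_fill_version` (file
`SLEKappaRho`), after

* G. F. Lawler, O. Schramm, W. Werner, *Conformal restriction: the chordal case*, J. Amer. Math.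
  Soc. **16** (2003) 917–955, arXiv:math/0209343 (**[LSW]**, arXiv page numbers): §8.1 p. 31
  (`Ω₊` and its σ-field), §8.3 pp. 35–36 (SLE(κ, ρ): "`Z_t` is `√κ` times a `d`-dimensional
  Bessel process … Note also that `∫₀ᵗ du/Z_u = (Z_t − √κ B_t)/(ρ + 2) < ∞` for all `t ≥ 0`.
  Then, set `O_t = −2 ∫₀ᵗ du/Z_u`, `W_t = Z_t + O_t`"), Lemma 8.3 (p. 36: for `κ ≤ 4`,
  `K_∞ ∩ ℝ = {0}` or `(−∞, 0]`, `K_∞` unbounded), Thm. 8.4 (p. 37: "let `K = F^{ℝ₊}_ℍ(cl K_∞)`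
  … Then `K` satisfies the right-sided restriction property") and the end of its proof (p. 38:
  "It remains to prove that a.s. `cl K_∞ ∩ A ≠ ∅` if and only if `K_∞ ∩ A ≠ ∅`").

The fact says: for `ρ > −2` and every SLE(8/3, ρ) driving pair `(O, W)` there is a measurable
map `Kc : (ℝ≥0 → ℝ) → Ω₊` with `Kc = F^{ℝ₊}_ℍ(cl K_∞)` (`sleKappaRhoFill W`) almost surely. In
[LSW] this is implicit in the statement of Thm. 8.4. Here it is PROVED
(`SLEKappaRho.exists_measurable_fill_version_of_leaves`) from two almost-sure sample-path
statements:

* `SLEKappaRho.integral_inv_eq` (file `SLEKappaRhoRestriction`) — NAMED FACT, §8.3 p. 36: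
  "`∫₀ᵗ du/Z_u = (Z_t − √κ B_t)/(ρ + 2) < ∞` for all `t ≥ 0`" (the integrated Bessel equation,
  Revuz–Yor Ch. XI, Exercise (1.26) 1°). It makes the Bochner integral `O_t = −2 ∫₀ᵗ du/Z_u` of
  `IsSLEKappaRhoPair` the true one and the driving function `t ↦ W_t(ω)` continuous for a.e. `ω`
  (`IsSLEKappaRhoPair.ae_continuous`, ibid.), hence [LSW] Lemma 8.3 (4), "`K_∞` is a.s. unbounded"
  (`SLEKappaRho.not_isBounded_hullUnion_of_integral_inv_eq`, file `SLEKappaRhoRestrictionProofs`: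
  the union of the hulls of any continuous driving function is unbounded, `hcap(K_t) = 2t`,
  `Loewner.not_isBounded_iUnion_hull` of `LoewnerHullCapacity`);
* `SLEKappaRho.ae_forall_ofReal_notMem_closure_hullUnion` — NAMED FACT, the closure form of
  Lemma 8.3 (2)–(3) on the positive axis: for SLE(8/3, ρ), almost surely no point of `(0, ∞)`
  lies in `cl K_∞`. Lemma 8.3 prints `K_∞ ∩ (0, ∞) = ∅` (for `κ ≤ 4`); that even the CLOSURE of
  `K_∞` misses `(0, ∞)` — the hulls do not accumulate at positive real points as `t → ∞` — is
  used implicitly by Thm. 8.4 (`K ∈ Ω₊` requires `K ∩ ℝ = (−∞, 0]`) and addressed at the end of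
  its proof (p. 38) through the avoidance formula itself. The sibling file
  `SLEKappaRhoRestriction` DERIVES it (`SLEKappaRho.ae_ofReal_notMem_closure_hullUnion`) from the
  printed leaves of §8.4 (the one-sided restriction martingale of Lemmas 8.9–8.10, Lemma 6.2,
  Lemma 6.3, Lemma 8.3 (2)–(3) and (4), and the integrated Bessel equation), whence
  `SLEKappaRho.ae_forall_ofReal_notMem_closure_hullUnion_of_restriction_leaves`; conversely the
  target implies it (`SLEKappaRho.ae_forall_ofReal_notMem_closure_hullUnion_of`), so this leaf is
  exactly as strong as needed.

Given these, for a.e. `ω` the set `F = cl K_∞(ω)` is closed, contained in `ℍ̄`, connected and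
contains `0` (`Loewner.isConnected_closure_hullUnion`, file `LoewnerHullUnion`: the closed hulls
of a continuous driving function are connected and increase), is unbounded and misses `(0, ∞)`;
so `F^{ℝ₊}_ℍ(F) ∈ Ω₊` (`leftFilling_mem_rightConfigs`, file `LeftFillingConfigs`: crossing lemma by
winding numbers). The version `Kc` is `F^{ℝ₊}_ℍ(cl K_∞(ω))` on a measurable set `G` of full
measure of such good `ω` and `(−∞, 0]` elsewhere. It is MEASURABLE for the σ-field generated by
the events `{K ∩ A = ∅}`, `A ∈ 𝒬₊`: on `G`, `F^{ℝ₊}_ℍ(F) ∩ A = ∅ ⟺ F ∩ A = ∅`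
(`disjoint_leftFilling_iff_of_isPlusHull`), and `{ω | cl K_∞(ω) ∩ A = ∅}` is measurable for
compact `A` as soon as the (continuous) driving functions depend measurably on `ω` through their
values (`Loewner.measurableSet_setOf_disjoint_closure_hullUnion`, file `LoewnerHullUnion`: hull
avoidance is open in the driving function for the topology of locally uniform convergence, by
the two-driver tube estimate, and a continuous-path process is a random element of path space);
the values `W_s = √κ X_s − 2 ∫₀ˢ du/(√κ X_u)` are measurable in `ω` on `G`
(`IsSLEKappaRhoPair.measurable_indicator_apply`: the Bessel process is adapted with continuous
paths there, so jointly measurable, and the parametric Bochner integral is measurable).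

Consequently (`SLEKappaRho.exists_measurable_fill_version_of_restriction_leaves`,
`SLEKappaRho.isRightRestrictionMeasure_fill_of_five_restriction_leaves`) **[LSW] Theorem 8.4 in
law form, `SLEKappaRho.isRightRestrictionMeasure_fill`, follows from the FIVE named facts of the
sibling decomposition** (`SLEKappaRho.integral_inv_eq`, `SLEKappaRho.exists_isOneSidedMartingale`,
`Loewner.restrictionDeriv_exitTime_gt`, `IsSmoothHull.restrictionDerivVanishesAtHit`,
`SLEKappaRho.swallowingTime_ofReal`), with no further hypothesis: the closure statement of the end
of the proof of Thm. 8.4 (p. 38, "a.s. `cl K_∞ ∩ A = ∅` iff `K_∞ ∩ A = ∅`" for a smooth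
`A ∈ 𝒬₊`) is not a separate leaf — it is PROVED from these five
(`SLEKappaRho.ae_disjoint_closure_iff_of_leaves`, file `SLEKappaRhoRestrictionProofs`).

Mathlib: `measurable_uncurry_of_continuous_of_measurable`,
`MeasureTheory.StronglyMeasurable.integral_prod_left`, `intervalIntegral.continuous_primitive`,
`MeasureTheory.exists_measurable_superset_of_null`, `measurable_generateFrom`.
-/

noncomputable section

open Set Filter Topology MeasureTheory Metric Bornology
open UpperHalfPlane (upperHalfPlaneSet)
open scoped NNReal ENNReal
open Literature.Analysis.FunctionSpaces (IsBesselProcess IsSquaredBesselProcess IsStrongSolution)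
open Literature.Probability.Process (preWienerMeasure brownian)

namespace Literature.Probability.RandomPlanarGeometry

/-! ### The closure leaf -/

/-- NAMED FACT — **no positive real point lies in `cl K_∞`, almost surely, for SLE(8/3, ρ)**,
`ρ > −2` (`K_∞ = ⋃_t K_t` the union of the Loewner hulls of the driving function `t ↦ W_t(ω)`,
`Loewner.hullUnion`). Printed support: [LSW] Lemma 8.3 (2)–(3) (p. 36: for `κ ≤ 4` and `ρ > −2`,
"a.s. `K_∞ ∩ ℝ = {0}`" if `ρ ≥ ρ₀`, "`K_∞ ∩ ℝ = (−∞, 0]`" if `ρ < ρ₀`; proof: "a.s. `1 ∉ K_t` for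
all `t ≥ 0` … Scale invariance then implies `K_∞ ∩ (0, ∞) = ∅` a.s."), and Thm. 8.4 (p. 37),
which treats `K = F^{ℝ₊}_ℍ(cl K_∞)` as a random element of `Ω₊`, so that `K ∩ ℝ = (−∞, 0]` and in
particular `cl K_∞ ∩ (0, ∞) = ∅`; the passage from `K_∞` to its closure (non-accumulation of the
hulls at positive real points as `t → ∞`) is implicit there and is addressed at the end of the
proof of Thm. 8.4 (p. 38: "a.s. `cl K_∞ ∩ A ≠ ∅` if and only if `K_∞ ∩ A ≠ ∅`") through the
avoidance formula (it would also follow from the continuity and transience of the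
SLE_κ(ρ) trace, Miller–Sheffield, *Imaginary geometry I* (2016), not in the tree). This is the
deep sample-path input of
`SLEKappaRho.exists_measurable_fill_version`, to which it is in fact equivalent given the rest
(`SLEKappaRho.ae_forall_ofReal_notMem_closure_hullUnion_of`).
[cite: LawlerSchrammWerner2003Restriction, Lemma 8.3 (2)–(3) (p. 36) with Thm. 8.4 (p. 37) and the end of its proof (p. 38)] -/
def SLEKappaRho.ae_forall_ofReal_notMem_closure_hullUnion : Prop :=
  ∀ {ρ : ℝ} {O W : ℝ≥0 → (ℝ≥0 → ℝ) → ℝ}, -2 < ρ → IsSLEKappaRhoPair (8 / 3) ρ O W →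
    ∀ᵐ ω ∂preWienerMeasure, ∀ x : ℝ, 0 < x → (x : ℂ) ∉ closure (Loewner.hullUnion fun t ↦ W t ω)

/-- **The target implies the second leaf**: if `F^{ℝ₊}_ℍ(cl K_∞)` has an `Ω₊`-valued version, then
a.s. it meets `ℝ` in `(−∞, 0]`, while it contains `cl K_∞ ⊆ ℍ̄`; so `cl K_∞` misses `(0, ∞)`.
[cite: LawlerSchrammWerner2003Restriction, Thm. 8.4 (p. 37) with §8.1 (p. 31)] -/
theorem SLEKappaRho.ae_forall_ofReal_notMem_closure_hullUnion_of
    (h : SLEKappaRho.exists_measurable_fill_version) :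
    SLEKappaRho.ae_forall_ofReal_notMem_closure_hullUnion := by
  intro ρ O W hρ hOW
  obtain ⟨Kc, -, hae⟩ := h hρ hOW
  filter_upwards [hae] with ω hω
  intro x hx hxcl
  have hmem : (x : ℂ) ∈ (Kc ω : Set ℂ) := by
    rw [hω]
    exact closure_hullUnion_subset_sleKappaRhoFill W ω hxcl
  have := (Kc ω).ofReal_mem_iff.1 hmem
  linarith

/-! ### The closure leaf from the printed leaves of §8.4 -/

/-- **The closure leaf from the leaves of the avoidance formula**: a.s. no positive real point
lies in `cl K_∞`, for SLE(8/3, ρ), given the five named facts from which the sibling file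
`SLEKappaRhoRestriction` derives it (`SLEKappaRho.ae_ofReal_notMem_closure_hullUnion`, the
argument of the end of the proof of [LSW] Thm. 7.3 run with half-ellipse hulls): the integrated
Bessel equation (§8.3), the one-sided restriction martingale (Lemmas 8.9–8.10), Lemma 6.2,
Lemma 6.3 and Lemma 8.3 (2)–(3) — Lemma 8.3 (4) being supplied by
`SLEKappaRho.not_isBounded_hullUnion_of_integral_inv_eq` (file `SLEKappaRhoRestrictionProofs`).
[cite: LawlerSchrammWerner2003Restriction, end of the proof of Thm. 8.4 (p. 38) with Lemma 8.3 (p. 36)] -/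
theorem SLEKappaRho.ae_forall_ofReal_notMem_closure_hullUnion_of_restriction_leaves
    (hint : SLEKappaRho.integral_inv_eq) (hM : SLEKappaRho.exists_isOneSidedMartingale)
    (h62 : Loewner.restrictionDeriv_exitTime_gt) (h63 : IsSmoothHull.restrictionDerivVanishesAtHit)
    (h83 : SLEKappaRho.swallowingTime_ofReal) :
    SLEKappaRho.ae_forall_ofReal_notMem_closure_hullUnion := by
  haveI : Fact Process.isProjectiveLimit_preWienerMeasure := ⟨isProjectiveLimit_preWienerMeasure_holds⟩
  intro ρ O W hρ hOW
  exact SLEKappaRho.ae_ofReal_notMem_closure_hullUnion hint hM h62 h63 h83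
    (SLEKappaRho.not_isBounded_hullUnion_of_integral_inv_eq hint) hρ hOW

/-! ### Measurability of the driving values on a good set -/

/-- **The driving values are measurable on a measurable set of continuous paths.** For an
SLE(κ, ρ) driving pair and a measurable set `G` of samples at which the Bessel process `X` has
continuous paths, each truncated value `𝟙_G W_s` is measurable: `X_s` is measurable
(`X = √Z`, `Z` adapted), `(u, ω) ↦ 𝟙_G(ω) X_u(ω)` is jointly measurable (continuous in `u`,
measurable in `ω`), and `ω ↦ ∫₀ˢ du/(√κ 𝟙_G X_u)` is a measurable parametric integral.
[folklore] -/
theorem IsSLEKappaRhoPair.measurable_indicator_apply {κ : ℝ≥0} {ρ : ℝ}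
    {O W X : ℝ≥0 → (ℝ≥0 → ℝ) → ℝ}
    (hX : IsBesselProcess (sleKappaRhoDim κ ρ) 0 X brownian brownianFiltration preWienerMeasure)
    (hO : ∀ t ω, O t ω = -2 * ∫ u in (0 : ℝ)..(t : ℝ), (Real.sqrt κ * X u.toNNReal ω)⁻¹)
    (hW : ∀ t ω, W t ω = Real.sqrt κ * X t ω + O t ω) {G : Set (ℝ≥0 → ℝ)} (hGm : MeasurableSet G)
    (hGc : ∀ ω ∈ G, Continuous fun t ↦ X t ω) (s : ℝ≥0) :
    Measurable (G.indicator (W s)) := by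
  classical
  obtain ⟨Z, hZ, hXZ⟩ := hX
  -- each `X u` is measurable
  have hXm : ∀ u : ℝ≥0, Measurable (X u) := fun u ↦ by
    have hZu : Measurable (Z u) := (hZ.adapted u).mono (brownianFiltration.le u) le_rfl
    have : X u = fun ω ↦ Real.sqrt (Z u ω) := funext fun ω ↦ hXZ u ω
    rw [this]
    exact hZu.sqrt
  -- the jointly measurable modification `𝟙_G X`
  set Xt : ℝ → (ℝ≥0 → ℝ) → ℝ := fun u ω ↦ if ω ∈ G then X u.toNNReal ω else 0 with hXt
  have hXt_cont : ∀ ω, Continuous fun u ↦ Xt u ω := fun ω ↦ by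
    by_cases hω : ω ∈ G
    · simp only [hXt, hω, if_true]
      exact (hGc ω hω).comp continuous_real_toNNReal
    · simp only [hXt, hω, if_false]
      exact continuous_const
  have hXt_meas : ∀ u, Measurable (Xt u) := fun u ↦
    Measurable.ite hGm (hXm _) measurable_const
  have hXt_joint : Measurable (Function.uncurry Xt) :=
    measurable_uncurry_of_continuous_of_measurable hXt_cont hXt_meas
  set Y : ℝ → (ℝ≥0 → ℝ) → ℝ := fun u ω ↦ (Real.sqrt κ * Xt u ω)⁻¹ with hY
  have hY_joint : StronglyMeasurable (Function.uncurry Y) :=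
    ((measurable_const.mul hXt_joint).inv).stronglyMeasurable
  -- the parametric integrals are measurable
  have hI : ∀ a b : ℝ, Measurable fun ω ↦ ∫ u in Ioc a b, Y u ω := fun a b ↦
    (hY_joint.integral_prod_left (μ := volume.restrict (Ioc a b))).measurable
  have hII : Measurable fun ω ↦ ∫ u in (0 : ℝ)..(s : ℝ), Y u ω := by
    simp only [intervalIntegral]
    exact (hI 0 s).sub (hI s 0)
  -- on `G` the truncated value is `√κ X_s - 2 ∫₀ˢ Y`
  have heq : G.indicator (W s) =
      G.indicator fun ω ↦ Real.sqrt κ * X s ω + -2 * ∫ u in (0 : ℝ)..(s : ℝ), Y u ω := by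
    funext ω
    by_cases hω : ω ∈ G
    · simp only [hω, indicator_of_mem, hW s ω, hO s ω]
      congr 2
      refine intervalIntegral.integral_congr fun u _ ↦ ?_
      simp only [hY, hXt, hω, if_true]
    · simp only [hω, indicator_of_notMem, not_false_eq_true]
  rw [heq]
  exact (((measurable_const.mul (hXm s)).add (measurable_const.mul hII))).indicator hGm

/-! ### The assembly -/

/-- **`K = F^{ℝ₊}_ℍ(cl K_∞)` of SLE(8/3, ρ) is a random element of `Ω₊`, from the leaves**: the
named fact `SLEKappaRho.exists_measurable_fill_version` ([LSW] Thm. 8.4 with §8.1 and Lemma 8.3: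
a measurable `Ω₊`-valued version of `F^{ℝ₊}_ℍ(cl K_∞)`) follows from the integrated Bessel
equation `∫₀ᵗ du/Z_u = (Z_t − √κ B_t)/(ρ + 2) < ∞` (§8.3, `SLEKappaRho.integral_inv_eq`) and the
closure form of Lemma 8.3 (2)–(3) on `(0, ∞)` (`SLEKappaRho.ae_forall_ofReal_notMem_closure_hullUnion`),
Lemma 8.3 (4) being a consequence of the former
(`SLEKappaRho.not_isBounded_hullUnion_of_integral_inv_eq`). See the module docstring for the proof. [cite: LawlerSchrammWerner2003Restriction, Thm. 8.4 (p. 37) with §8.1 (p. 31), Lemma 8.3 (p. 36), §8.3 (p. 36)] -/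
theorem SLEKappaRho.exists_measurable_fill_version_of_leaves
    (hint : SLEKappaRho.integral_inv_eq)
    (h1 : SLEKappaRho.ae_forall_ofReal_notMem_closure_hullUnion) :
    SLEKappaRho.exists_measurable_fill_version := by
  classical
  intro ρ O W hρ hOW
  have h2 : SLEKappaRho.not_isBounded_hullUnion :=
    SLEKappaRho.not_isBounded_hullUnion_of_integral_inv_eq hint
  have hκ : (0 : ℝ≥0) < 8 / 3 := by norm_num
  obtain ⟨X, hX, hO, hW⟩ := id hOW
  obtain ⟨Z, hZ, hXZ⟩ := id hX
  have hXae : ∀ᵐ ω ∂preWienerMeasure, Continuous fun t ↦ X t ω := by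
    filter_upwards [IsStrongSolution.ae_continuous hZ] with ω hZc
    have : (fun t ↦ X t ω) = fun t ↦ Real.sqrt (Z t ω) := funext fun t ↦ hXZ t ω
    rw [this]
    exact Real.continuous_sqrt.comp hZc
  -- the good samples: continuous `W` and `X`, no positive point in `cl K_∞`, `K_∞` unbounded
  have hgood : ∀ᵐ ω ∂preWienerMeasure, (Continuous (fun t ↦ W t ω) ∧ Continuous (fun t ↦ X t ω)) ∧
      (∀ x : ℝ, 0 < x → (x : ℂ) ∉ closure (Loewner.hullUnion fun t ↦ W t ω)) ∧
      ¬ IsBounded (Loewner.hullUnion fun t ↦ W t ω) := by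
    filter_upwards [hOW.ae_continuous hint hκ hρ, hXae, h1 hρ hOW, h2 hκ hρ hOW] with ω h hx h' h''
    exact ⟨⟨h.1, hx⟩, h', h''⟩
  rw [ae_iff] at hgood
  obtain ⟨N, hNsub, hNm, hN0⟩ := exists_measurable_superset_of_null hgood
  set G : Set (ℝ≥0 → ℝ) := Nᶜ with hGdef
  have hGm : MeasurableSet G := hNm.compl
  have hG : ∀ ω ∈ G, (Continuous (fun t ↦ W t ω) ∧ Continuous (fun t ↦ X t ω)) ∧
      (∀ x : ℝ, 0 < x → (x : ℂ) ∉ closure (Loewner.hullUnion fun t ↦ W t ω)) ∧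
      ¬ IsBounded (Loewner.hullUnion fun t ↦ W t ω) := fun ω hω ↦ by
    by_contra hcon
    exact hω (hNsub hcon)
  have hGae : ∀ᵐ ω ∂preWienerMeasure, ω ∈ G := by
    rw [ae_iff]
    have : {ω : ℝ≥0 → ℝ | ¬ω ∈ G} = N := by
      ext ω
      simp [hGdef]
    rw [this]
    exact hN0
  -- `F = cl K_∞(ω)` is left-fillable on `G`
  have hfill : ∀ ω ∈ G, leftFilling (closure (Loewner.hullUnion fun t ↦ W t ω)) ∈ rightConfigs := by
    intro ω hω
    obtain ⟨⟨hc, -⟩, hpos, hunb⟩ := hG ω hω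
    have h0 : (0 : ℂ) ∈ closure (Loewner.hullUnion fun t ↦ W t ω) := by
      have := Loewner.ofReal_driving_mem_closure_hullUnion hc
      rwa [hOW.snd_zero ω, Complex.ofReal_zero] at this
    exact leftFilling_mem_rightConfigs isClosed_closure (Loewner.closure_hullUnion_subset _)
      (Loewner.isConnected_closure_hullUnion hc) h0 (fun hb ↦ hunb (hb.subset subset_closure)) hpos
  -- the version
  let Kc : (ℝ≥0 → ℝ) → RightConfig := fun ω ↦
    if hω : ω ∈ G then ⟨leftFilling (closure (Loewner.hullUnion fun t ↦ W t ω)), hfill ω hω⟩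
    else RightConfig.negAxis
  refine ⟨Kc, ?_, ?_⟩
  swap
  · filter_upwards [hGae] with ω hω
    simp only [Kc, hω, dif_pos]
    rfl
  -- the regularised driving function as a random element of path space
  let Φ : (ℝ≥0 → ℝ) → C(ℝ≥0, ℝ) := fun ω ↦
    if hω : ω ∈ G then ⟨fun t ↦ W t ω, (hG ω hω).1.1⟩ else 0
  have hΦ_apply : ∀ ω s, Φ ω s = if ω ∈ G then W s ω else 0 := fun ω s ↦ by
    by_cases hω : ω ∈ G
    · simp only [Φ, hω, dif_pos, if_true]
      rfl
    · simp only [Φ, hω, dif_neg, if_false, not_false_eq_true]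
      rfl
  have hΦG : ∀ ω ∈ G, (Φ ω : ℝ≥0 → ℝ) = fun t ↦ W t ω := fun ω hω ↦ by
    funext s
    rw [hΦ_apply, if_pos hω]
  have hΦm : ∀ s, Measurable fun ω ↦ Φ ω s := fun s ↦ by
    have : (fun ω ↦ Φ ω s) = G.indicator (W s) := by
      funext ω
      rw [hΦ_apply, indicator_apply]
    rw [this]
    exact IsSLEKappaRhoPair.measurable_indicator_apply hX hO hW hGm (fun ω hω ↦ (hG ω hω).1.2) s
  -- measurability of `Kc` on the generating events
  refine measurable_generateFrom ?_
  rintro _ ⟨A, hA, rfl⟩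
  have hAc : IsCompact A := hA.1.isBoundedHull.isCompact
  have hrep : Kc ⁻¹' RightConfig.avoid A =
      (G ∩ {ω | Disjoint (closure (Loewner.hullUnion (Φ ω))) A}) ∪ Gᶜ := by
    ext ω
    simp only [mem_preimage, RightConfig.mem_avoid, mem_union, mem_inter_iff, mem_setOf_eq,
      mem_compl_iff]
    by_cases hω : ω ∈ G
    · simp only [Kc, hω, dif_pos, true_and, not_true_eq_false, or_false]
      show Disjoint (leftFilling (closure (Loewner.hullUnion fun t ↦ W t ω))) A ↔ _
      rw [disjoint_leftFilling_iff_of_isPlusHull (hG ω hω).2.1 hA, hΦG ω hω]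
    · simp only [Kc, hω, dif_neg, not_false_eq_true, false_and, or_true, iff_true]
      exact hA.disjoint_nonposAxis.symm
  rw [hrep]
  exact (hGm.inter (Loewner.measurableSet_setOf_disjoint_closure_hullUnion hΦm hAc)).union hGm.compl

/-! ### Theorem 8.4 from the printed leaves of §8 -/

/-- **`K` is a random element of `Ω₊`, from the leaves of the sibling decomposition**: the named
fact `SLEKappaRho.exists_measurable_fill_version` follows from five of the named facts from
which `SLEKappaRhoRestriction` derives the avoidance formula — the integrated Bessel equation
(§8.3), the one-sided restriction martingale (Lemmas 8.9–8.10), Lemma 6.2, Lemma 6.3 and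
Lemma 8.3 (2)–(3). [cite: LawlerSchrammWerner2003Restriction, Thm. 8.4 (p. 37) with §8.1 (p. 31), Lemma 8.3, §8.4] -/
theorem SLEKappaRho.exists_measurable_fill_version_of_restriction_leaves
    (hint : SLEKappaRho.integral_inv_eq) (hM : SLEKappaRho.exists_isOneSidedMartingale)
    (h62 : Loewner.restrictionDeriv_exitTime_gt) (h63 : IsSmoothHull.restrictionDerivVanishesAtHit)
    (h83 : SLEKappaRho.swallowingTime_ofReal) : SLEKappaRho.exists_measurable_fill_version :=
  SLEKappaRho.exists_measurable_fill_version_of_leaves hint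
    (SLEKappaRho.ae_forall_ofReal_notMem_closure_hullUnion_of_restriction_leaves hint hM h62 h63 h83)

/-- **[LSW] Theorem 8.4 in law form from FIVE printed leaves**: the law of the `Ω₊`-valued
version of `F^{ℝ₊}_ℍ(cl K_∞)` for SLE(8/3, ρ) is the right-sided restriction measure `P⁺_{α(ρ)}`
(`SLEKappaRho.isRightRestrictionMeasure_fill`), given the integrated Bessel equation (§8.3,
`SLEKappaRho.integral_inv_eq`), the one-sided restriction martingale (Lemmas 8.9–8.10,
`SLEKappaRho.exists_isOneSidedMartingale`), Lemma 6.2 (`Loewner.restrictionDeriv_exitTime_gt`),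
Lemma 6.3 (`IsSmoothHull.restrictionDerivVanishesAtHit`) and Lemma 8.3 (2)–(3)
(`SLEKappaRho.swallowingTime_ofReal`) — by `SLEKappaRho.isRightRestrictionMeasure_fill_of_five_leaves`
(file `SLEKappaRhoRestrictionProofs`: the avoidance formula from the five leaves, the closure
statement of the end of the proof of Thm. 8.4 being proved from them,
`SLEKappaRho.ae_disjoint_closure_iff_of_leaves`) and the measurable version
`SLEKappaRho.exists_measurable_fill_version_of_restriction_leaves`.
[cite: LawlerSchrammWerner2003Restriction, Thm. 8.4 (p. 37) and its proof (§8.4)] -/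
theorem SLEKappaRho.isRightRestrictionMeasure_fill_of_five_restriction_leaves
    (hint : SLEKappaRho.integral_inv_eq) (hM : SLEKappaRho.exists_isOneSidedMartingale)
    (h62 : Loewner.restrictionDeriv_exitTime_gt) (h63 : IsSmoothHull.restrictionDerivVanishesAtHit)
    (h83 : SLEKappaRho.swallowingTime_ofReal) : SLEKappaRho.isRightRestrictionMeasure_fill :=
  SLEKappaRho.isRightRestrictionMeasure_fill_of_five_leaves
    (SLEKappaRho.exists_measurable_fill_version_of_restriction_leaves hint hM h62 h63 h83)
    hint hM h62 h63 h83

end Literature.Probability.RandomPlanarGeometry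

end
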